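import Summits.BirchSwinnertonDyer.BirchSwinnertonDyer.Theorems.PrintX10bBeyondCarrierOfMuStabilized
import Summits.BirchSwinnertonDyer.BirchSwinnertonDyer.Theorems.PrintX9MuPartStabilizedDefs
import Summits.BirchSwinnertonDyer.Rank1Residual.X9.LeafDischargeScalarImage
import HarnessLib

/-!
# Crux `BeyondCarrierDepthX10b` (stmt-BirchSwinnertonDyer-23055, PrintX10b aside r301), line «twins», skeleton
# v6.2: the crux BY NAME from the SHARED, FRAME-FREE μ-LETTER `HeegnerMuPartStabilized.MuPartStabilizedOfPrint`
# (the cell's ONE μ-item of rows 9/10, plan g10 THE CUT / FINAL FAMILY) — modulo twelve cite-only facts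

HONEST FRAMING (cell `run/shared/lean/pub/bsd-print-x9/`, seat bsd-line-x10b-p1 LEAD g4 on the registered line
«twins» of crux 23055, D-0154 KEY row 10): THEOREMS ONLY, conditional glue `--supports 23055`; nothing booked,
nothing closed. «beyond-print theorem»: NO. BSD is not proved by any of this; no summit statement is proved by
this seat.

WHY. The census of record for crux 23055 (seat x10b-p1-w2 g3, `PrintX10bBeyondCarrierOfMuStabilized`,
`beyondCarrierDepthX10b_of_muStabilized_of_namedFacts`) reads: 23055 BY NAME ⟸ ONE open statement `hμC` — the
μ-inequality `length_(p)(𝒳_tors) ≤ 2·length_(p)(𝔖/Λκ_∞(C))` on the rank-one `3 ∣ h_K` X10b Heegner FRAMES —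
plus cite-only facts. The pen's cut of the two deciding cruxes of rows 9/10 (plan g10, 2026-08-28T10:51Z/10:59Z)
files that μ-residual ONCE, frame-free, as the letter `HeegnerMuPartStabilized.MuPartStabilizedOfPrint`
(x9-p1-w2 g3, `PrintX9MuPartStabilizedDefs`): for every level `N`, curve, field, `(κ, γ)`, `jbar`, UNDER
`CastellaGrossiLeeSkinner2022.Thm413Hypotheses N W K p κ γ` + `¬ CM` + `E[p]` irreducible over `ℚ` and over `K`
+ `MastellaZerman2026.HasPadicScalarImage W p` + `p` split in `K` + `p ∣ h_K`. This file discharges those print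
hypotheses on the X10b frames IN THE KERNEL — `X10.thm413Hypotheses_of_classX10` (CGLS §3.2 (h1) from (irr) at
`3` over a quadratic field, `3 ∤ d_K` from `3` split, ordinary from `ClassX10`), `ClassX10.irr`,
`ClassX10.hasPadicScalarImage_of_not_surj` (Lombardo–Tronto 2022 Prop. 3.12, proved in the tree) — so that
`hμC` follows from the shared letter (the rank / `Ш` binders of `hμC` are idle), and composes with the census.
CENSUS after this file (numbers): crux 23055 BY NAME ⟸ the shared μ-letter `MuPartStabilizedOfPrint` (ONE
statement, beyond citable print at `3 ∣ h_K`: cell referee REF-118) + 12 cite-only facts (`h46` MZ26 Cor. 4.6 for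
`3 ∤ h_K`; `hNV` CGLS Thm. 4.1.1, `hCGLS` CGLS Thm. 4.1.3, `hTw` tower clause `K_k ⊆ K[p^{k+1}]` for `3 ∣ h_K`;
`h57 h59gp h422 h513 hC` pinned transfer; `h331`; `hChaL`, `hKo` glue).

WHAT.
* `muStabilizedX10b_of_muPartStabilizedOfPrint : MuPartStabilizedOfPrint → hμC` (the frame discharge).
* `beyondCarrierDepthX10b_of_muPartStabilizedOfPrint_of_namedFacts (h46 hNV hCGLS hTw h57 h59gp h422 h513 hC h331
  hChaL hKo) (hμ : MuPartStabilizedOfPrint) : BeyondCarrierDepthX10b`.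

References: [MastellaZerman2026] Ass. 2.1 (iii), 2.13 (v), Cor. 4.6; [LombardoTronto2022] Prop. 3.12;
[CastellaGrossiLeeSkinner2022] §3.2 (h1), Thm. 4.1.1, Thm. 4.1.3; [Howard2004HeegnerKolyvagin] Thm. 2.2.10 (proof:
`𝔮 = T^m + p`); companion `PrintX10bBeyondCarrierOfMuStabilized.lean`; skeleton v6.2
`Cruxes/BeyondCarrierDepthX10b/Lines/twins.lean`.
-/

-- the REGISTERED stub namespace `Summit.BirchSwinnertonDyer.BirchSwinnertonDyer.Cruxes.…` repeats the summit name
set_option linter.dupNamespace false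
set_option autoImplicit false

noncomputable section

open scoped Classical

open WeierstrassCurve NumberField IsDedekindDomain Field Literature.NumberTheory.EllipticCurves
  Literature.NumberTheory.EllipticCurves.ModularForms Literature.NumberTheory.EllipticCurves.Rank1Residual
  Literature.NumberTheory.EllipticCurves.Castella2018 Literature.NumberTheory.EllipticCurves.YanZhu2026
  Literature.NumberTheory.EllipticCurves.CastellaGrossiLeeSkinner2022
  Literature.NumberTheory.EllipticCurves.JetchevSkinnerWan2017

open Summit.BirchSwinnertonDyer.Rank1Residual
open Summit.BirchSwinnertonDyer.BirchSwinnertonDyer.Rank1Residual (X10.thm413Hypotheses_of_classX10)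
open Summit.BirchSwinnertonDyer.BirchSwinnertonDyer.Theorems.HeegnerMuPartStabilized (MuPartStabilizedOfPrint)
open Summit.BirchSwinnertonDyer.BirchSwinnertonDyer.Theses.PrintX10b (BeyondCarrierDepthX10b)

namespace Summit.BirchSwinnertonDyer.BirchSwinnertonDyer.Cruxes.BeyondCarrierDepthX10b.HowardFrames

/-- **The frame-ful stabilised μ-inequality `hμC` of the census from the shared frame-free letter**: on a
rank-one `3 ∣ h_K` X10b Heegner frame every printed hypothesis of the letter holds in the kernel —
`Thm413Hypotheses` by `X10.thm413Hypotheses_of_classX10`, `¬ CM` and (irr) over `K` are frame binders, (irr) over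
`ℚ` is `ClassX10.irr`, the scalars `1 + 3ℤ_3` by `ClassX10.hasPadicScalarImage_of_not_surj` (Lombardo–Tronto
2022 Prop. 3.12), `p` split is the frame's `SatisfiesHeegnerHypothesis p K`; rank and `Ш` binders idle.
[cite: LombardoTronto2022, Prop. 3.12] [cite: MastellaZerman2026, Assumption 2.13 (v)]
[cite: CastellaGrossiLeeSkinner2022, §3.2 standing hypotheses (h1)] -/
theorem muStabilizedX10b_of_muPartStabilizedOfPrint (hμ : MuPartStabilizedOfPrint) :
    ∀ (W : WeierstrassCurve ℚ) [W.IsElliptic] [W.IsGloballyMinimal] (p : ℕ) [Fact p.Prime]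
      [NeZero (W.conductorNorm ℤ)] (K : Type) [Field K] [NumberField K],
      Literature.NumberTheory.EllipticCurves.Rank1Residual.ClassX10 W p →
      ¬ Literature.NumberTheory.EllipticCurves.Rank1Residual.Surj W 3 → ¬ W.HasCM →
      Literature.NumberTheory.EllipticCurves.IsImaginaryQuadratic K → Odd (NumberField.discr K) →
      NumberField.discr K ≠ -3 →
      Literature.NumberTheory.EllipticCurves.SatisfiesHeegnerHypothesis (W.conductorNorm ℤ) K →
      Literature.NumberTheory.EllipticCurves.SatisfiesHeegnerHypothesis p K →
      p ∣ NumberField.classNumber K →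
      (W.baseChange K).HasIrreducibleModPGaloisRep p →
      ∀ (κ : Literature.NumberTheory.EllipticCurves.ZpExtension K p), κ.IsAnticyclotomic →
      ∀ (γ : Field.absoluteGaloisGroup K), κ.IsTopGenerator γ →
      ∀ (jbar : AlgebraicClosure K →+* ℂ),
      (W.baseChange K).mordellWeilRank = 1 →
      Finite (AddCommGroup.primaryComponent (W.baseChange K).sha p) →
      ∀ (D : (W.baseChange K).LambdaAdicSelmerData κ γ)
        (C : Literature.NumberTheory.EllipticCurves.CastellaGrossiLeeSkinner2022.StabilizedHeegnerData
          (W.conductorNorm ℤ) W K κ jbar)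
        (X : (W.baseChange K).SelmerDualData κ γ),
        Module.Finite (Literature.NumberTheory.EllipticCurves.IwasawaAlgebra p) D.S →
        Module.Finite (Literature.NumberTheory.EllipticCurves.IwasawaAlgebra p) X.X →
        Module.IsTorsion (Literature.NumberTheory.EllipticCurves.IwasawaAlgebra p)
          (D.S ⧸ Literature.NumberTheory.EllipticCurves.CastellaGrossiLeeSkinner2022.stabilizedHeegnerModule
            D C) →
      ∀ 𝔭 : PrimeSpectrum (Literature.NumberTheory.EllipticCurves.IwasawaAlgebra p),
        𝔭.asIdeal = Ideal.span {(p : Literature.NumberTheory.EllipticCurves.IwasawaAlgebra p)} →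
        Module.lengthAt (Literature.NumberTheory.EllipticCurves.IwasawaAlgebra p)
          (Submodule.torsion (Literature.NumberTheory.EllipticCurves.IwasawaAlgebra p) X.X) 𝔭 ≤
        2 * Module.lengthAt (Literature.NumberTheory.EllipticCurves.IwasawaAlgebra p)
          (D.S ⧸ Literature.NumberTheory.EllipticCurves.CastellaGrossiLeeSkinner2022.stabilizedHeegnerModule
            D C) 𝔭 := by
  intro W _ _ p _ _ K _ _ hX hns hcm hK hodd h3 hHN hHp hhK hirr κ hκ γ hγ jbar _ _ D C X hfinS hfinX htorC 𝔭 h𝔭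
  exact hμ (W.conductorNorm ℤ) W K p κ γ jbar (X10.thm413Hypotheses_of_classX10 hX hK h3 hHN hHp hodd hκ hγ) hcm
    hX.irr hirr (hX.hasPadicScalarImage_of_not_surj hns) hHp hhK D C X hfinS hfinX htorC 𝔭 h𝔭

/-- **Crux 23055 `BeyondCarrierDepthX10b` BY NAME from the shared frame-free μ-letter `MuPartStabilizedOfPrint`,
modulo twelve cite-only facts** (`h46` MZ26 Cor. 4.6 — the `3 ∤ h_K` frames; `hNV hCGLS hTw` CGLS Thm. 4.1.1 /
Thm. 4.1.3 / tower clause — the `3 ∣ h_K` frames; `h57 h59gp h422 h513 hC` the pinned class-number-free transfer;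
`h331` JSW control; `hChaL hKo` the glue U₃ → body): the census `beyondCarrierDepthX10b_of_muStabilized_of_namedFacts`
fed with `muStabilizedX10b_of_muPartStabilizedOfPrint hμ`. CONDITIONAL; credits nothing by itself.
[cite: MastellaZerman2026, Cor. 4.6] [cite: CastellaGrossiLeeSkinner2022, Thm. 4.1.1, Rem. 4.1.4, Thm. 4.1.3]
[cite: Howard2004HeegnerKolyvagin, Thm. 2.2.10 (proof) and §3.3] [cite: YanZhu2024MainConjNonCM, Thm. 5.7 (1) and Thm. 5.9]
[cite: BurungaleCastellaSkinner2025, Prop. 4.2.2] [cite: JetchevSkinnerWan2017, Thm. 3.3.1] [cite: Cha2005, Rmk. 25]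
[cite: Kolyvagin1990, Thm. A] -/
theorem beyondCarrierDepthX10b_of_muPartStabilizedOfPrint_of_namedFacts
    (h46 : MastellaZerman2026.cor46_howardDivisibility_of_scalarImage.{0})
    (hNV : thm411_torsionFree_heegnerClass_ne_bot_quotient_isTorsion.{0})
    (hCGLS : thm413_rankOne_charIdeal_torsion_dvd_localized.{0})
    (hTw : ∀ (K : Type) [Field K] [NumberField K] (p : ℕ) [Fact p.Prime], Odd p →
      Literature.NumberTheory.EllipticCurves.IsImaginaryQuadratic K →
      ∀ (κ : Literature.NumberTheory.EllipticCurves.ZpExtension K p), κ.IsAnticyclotomic →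
      ∀ (jbar : AlgebraicClosure K →+* ℂ) (k : ℕ),
      Literature.NumberTheory.EllipticCurves.ringClassSubgroup K (p ^ (k + 1)) jbar ≤ κ.layerSubgroup k)
    (h57 : thm57_isTorsion_charIdealXGr_eq_bdpLFunction)
    (h59gp : ∀ {p : ℕ} [Fact p.Prime] (ι' : PadicAlgCl p ≃+* ℂ) (W : WeierstrassCurve ℚ) [W.IsElliptic]
      [W.IsGloballyMinimal] (K : Type) [Field K] [NumberField K] (v vbar : HeightOneSpectrum (𝓞 K))
      (κ : ZpExtension K p) (γ : absoluteGaloisGroup K) [Fact (κ.IsTopGenerator γ)] {N : ℕ} [NeZero N]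
      {f : CuspForm (CongruenceSubgroup.Gamma0 N) 2} (jbar : AlgebraicClosure K →+* ℂ)
      (_ : IsNewformOf W f),
      N = W.conductorNorm ℤ → 3 ≤ p → GoodOrd W p → (W.baseChange K).HasIrreducibleModPGaloisRep p →
      IsImaginaryQuadratic K → SatisfiesHeegnerHypothesis N K →
        ((Ideal.span {(p : ℤ)}).primesOver (𝓞 K)).ncard = 2 →
        Odd (NumberField.discr K) → NumberField.discr K ≠ -3 → κ.IsAnticyclotomic →
      (∀ (w : InfinitePlace K) (k : 𝓞 K), k ∈ v.asIdeal ↔ ‖ι'.symm (w.embedding (k : K))‖ < 1) →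
        ((p : ℕ) : 𝓞 K) ∈ vbar.asIdeal → vbar ≠ v →
      ∃ (ΩK : ℂ) (Ωp : (unrIntegers p)ˣ) (L : UnrSeries p),
        ΩK ≠ 0 ∧ IsBDPLFunction ι' v κ γ f ΩK ((Ωp : unrIntegers p) : ℂ_[p]) L ∧
        ∀ (D : (W.baseChange K).LambdaAdicSelmerData κ γ) (F : HeegnerFamily N W K κ jbar)
          (X : (W.baseChange K).SelmerDualData κ γ) (j : ℤ_[p] →+* unrIntegers p),
          ¬ (p : ℤ) ∣ F.Dt.c →
          (∀ x : ℤ_[p], ((j x : unrIntegers p) : ℂ_[p]) = algebraMap ℚ_[p] ℂ_[p] (x : ℚ_[p])) →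
          heegnerCharIdeal D F ^ 2 ≤
              Module.charIdeal (IwasawaAlgebra p) (Submodule.torsion (IwasawaAlgebra p) X.X) →
            L ∈ (AcSelmer.XAc.charIdeal (W.baseChange K) p κ vbar ∅ γ).map (PowerSeries.map j))
    (h422 : BurungaleCastellaSkinner2025.prop422_exists_isBDPLFunction_mu_eq_zero)
    (h513 : thm513_exists_isBDPLFunction_valueAtOne_disc)
    (hC : ∀ (N : ℕ) [NeZero N], IsNewformOf.level_eq_conductorNorm (N := N))
    (h331 : thm331_anticyclotomicControl)
    (hChaL : Cha2005.rmk25_pow_dvd_card_sha_primary_of_certificate)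
    (hKo : ∀ (N : ℕ) [NeZero N] (W : WeierstrassCurve ℚ) (K : Type) [Field K] [NumberField K],
      kolyvagin N W K)
    (hμ : MuPartStabilizedOfPrint) :
    BeyondCarrierDepthX10b :=
  beyondCarrierDepthX10b_of_muStabilized_of_namedFacts h46 hNV hCGLS hTw h57 h59gp h422 h513 hC h331 hChaL hKo
    (muStabilizedX10b_of_muPartStabilizedOfPrint hμ)

end Summit.BirchSwinnertonDyer.BirchSwinnertonDyer.Cruxes.BeyondCarrierDepthX10b.HowardFrames

end
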